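import Literature.Topology.FourManifolds.MMSWPictureModelInj
import HarnessLib

/-!
# Gluing data of a surgery presentation, seen from the model

Topic `Literature/Topology/FourManifolds`; part of the proof of the named fact
`Literature.Topology.FourManifolds.pictureSurgeryPresentation` (`MMSWPictureSurgery.lean`; Kirby,
*The Topology of 4-Manifolds*, LNM 1374 (1989), Ch. I §2, Lemma 2.1).  Everything here is proved;
no named fact is introduced.

The structure `Gluing k η Y` packages what the model-side arguments use of a surgery presentation of
`Y` on the link `U_1 ∪ ⋯ ∪ U_k ∪ K'` (thin round `0`-framed tubes about the dotted circles, an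
arbitrary `0`-framed tube `T'` about `K'`): the maps `JA` (link complement `LC → Y`) and `JB i`
(solid tori `→ Y`) with their one-sided inverses, injectivity, openness and smoothness on the
relevant open sets, the glue relations, the covering property, and the model knot `KC` with its
relation to `T'`.  It is DATA with hypotheses, not a named proposition; `MMSWPictureSurgery`
constructs an instance from the hypotheses of `pictureSurgeryPresentation`.

Here we derive the consequences used downstream: the disc coordinate of a glued point is nonzero
(`glue_fst_ne_zero`), the pieces agree on the inner core zones (`agree`), the complement
`Sset = Mset ∖ KC` of the knot in the model lies in the good set (`Sset_subset_goodSet`), and the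
model map is injective on it (`injOn`) and smooth on the good set (`contMDiffOn`).

## References

* R. Kirby, *The Topology of 4-Manifolds*, LNM 1374 (1989), Ch. I §2. [Kirby1989]
-/

open scoped Manifold ContDiff Topology Real ComplexConjugate
open Function Set Metric

noncomputable section

namespace Literature.Topology.FourManifolds

/-- Local notation: `𝔼 n` is the model Euclidean space `EuclideanSpace ℝ (Fin n)`. -/
local notation "𝔼 " n:arg => EuclideanSpace ℝ (Fin n)
/-- Local notation: `𝕊 n` is the unit sphere of `EuclideanSpace ℝ (Fin (n + 1))`. -/
local notation "𝕊 " n:arg => (Metric.sphere (0 : EuclideanSpace ℝ (Fin (n + 1))) 1)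

namespace MMSW

/-- **Gluing data of a surgery presentation seen from the model `M_k`** (see the module
docstring). [folklore] -/
structure Gluing (k : ℕ) (η : ℝ) (Y : Type*) [TopologicalSpace Y] [ChartedSpace (𝔼 3) Y] where
  /-- The link complement, extended to the sphere. -/
  JA : (𝕊 3) → Y
  /-- The glued-in solid tori, extended to `ℝ² × 𝕊¹`. -/
  JB : Fin (k + 1) → (𝔼 2) × (𝕊 1) → Y
  /-- The reflection flags of the thin tubes of the dotted circles. -/
  fl : Fin k → Bool
  /-- The link complement. -/
  LC : Set (𝕊 3)
  /-- A left inverse of `JA` on `LC`. -/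
  JAinv : Y → (𝕊 3)
  /-- Left inverses of the `JB i` on the open solid torus. -/
  JBinv : Fin (k + 1) → Y → (𝔼 2) × (𝕊 1)
  /-- The model knot in complex coordinates. -/
  KC : (𝕊 1) → ℂ × ℂ
  /-- The tube about the last component `K'`. -/
  T' : (𝕊 1) × (𝔼 2) → (𝕊 3)
  /-- The compression parameter is positive. -/
  hη : 0 < η
  /-- The compression parameter is at most `1/40`. -/
  hη' : η ≤ 1 / 40
  /-- The link complement is open. -/
  isOpen_LC : IsOpen LC
  /-- `JA` is smooth on the link complement. -/
  JA_smooth : ContMDiffOn (𝓡 3) (𝓡 3) ∞ JA LC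
  /-- The `JB i` are smooth on the open solid torus. -/
  JB_smooth : ∀ i, ContMDiffOn (𝓘(ℝ, 𝔼 2).prod (𝓡 1)) (𝓡 3) ∞ (JB i) {b | ‖b.1‖ < 1}
  /-- `JA` is injective on the link complement. -/
  JA_inj : InjOn JA LC
  /-- The `JB i` are injective on the open solid torus. -/
  JB_inj : ∀ i, InjOn (JB i) {b : (𝔼 2) × (𝕊 1) | ‖b.1‖ < 1}
  /-- The glued-in open solid tori are pairwise disjoint. -/
  JB_disj : ∀ i i' (b b' : (𝔼 2) × (𝕊 1)), i ≠ i' → ‖b.1‖ < 1 → ‖b'.1‖ < 1 → JB i b ≠ JB i' b'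
  /-- `JA` is an open map on the link complement. -/
  JA_open : ∀ U : Set (𝕊 3), IsOpen U → U ⊆ LC → IsOpen (JA '' U)
  /-- The `JB i` are open maps on the open solid torus. -/
  JB_open : ∀ i (U : Set ((𝔼 2) × (𝕊 1))), IsOpen U → U ⊆ {b | ‖b.1‖ < 1} → IsOpen (JB i '' U)
  /-- `JAinv` is a left inverse of `JA` on the link complement. -/
  JAinv_JA : ∀ a ∈ LC, JAinv (JA a) = a
  /-- `JBinv i` is a left inverse of `JB i` on the open solid torus. -/
  JBinv_JB : ∀ i (b : (𝔼 2) × (𝕊 1)), ‖b.1‖ < 1 → JBinv i (JB i b) = b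
  /-- `JAinv` is smooth on the image of the link complement. -/
  JAinv_smooth : ContMDiffOn (𝓡 3) (𝓡 3) ∞ JAinv (JA '' LC)
  /-- `JBinv i` is smooth on the image of the open solid torus. -/
  JBinv_smooth : ∀ i, ContMDiffOn (𝓡 3) (𝓘(ℝ, 𝔼 2).prod (𝓡 1)) ∞ (JBinv i) (JB i '' {b | ‖b.1‖ < 1})
  /-- The pieces cover `Y`. -/
  cover : ∀ y : Y, (∃ a ∈ LC, JA a = y) ∨ ∃ i, ∃ b : (𝔼 2) × (𝕊 1), ‖b.1‖ < 1 ∧ JB i b = y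
  /-- The glue relation at a dotted circle (thin round tube, possibly reflected). -/
  glueA : ∀ (j : Fin k), ∀ a ∈ LC, ∀ b : (𝔼 2) × (𝕊 1), ‖b.1‖ < 1 →
    (JA a = JB (Fin.castSucc j) b ↔ ∃ (u : 𝕊 1) (t : ℝ), t ∈ Ioo (0 : ℝ) 1 ∧
      b.1 = t • (u : 𝔼 2) ∧ a = dottedTubeFun k j (u, t • flipE (fl j) (b.2 : 𝔼 2)))
  /-- The glue relation at the last component (tube `T'`). -/
  glueL : ∀ a ∈ LC, ∀ b : (𝔼 2) × (𝕊 1), ‖b.1‖ < 1 →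
    (JA a = JB (Fin.last k) b ↔ ∃ (u : 𝕊 1) (t : ℝ), t ∈ Ioo (0 : ℝ) 1 ∧
      b.1 = t • (u : 𝔼 2) ∧ a = T' (u, t • (b.2 : 𝔼 2)))
  /-- The punctured thin tubes of the dotted circles lie in the link complement. -/
  tubeA_mem : ∀ (j : Fin k) (u : 𝕊 1) (v : 𝔼 2), v ≠ 0 → ‖v‖ < 1 → dottedTubeFun k j (u, v) ∈ LC
  /-- The dotted circles are not in the link complement. -/
  LC_dotted : ∀ (j : Fin k) (θ : 𝕊 1), dottedCircle k j θ ∉ LC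
  /-- The punctured tube of the last component lies in the link complement. -/
  T'_mem : ∀ (u : 𝕊 1) (v : 𝔼 2), v ≠ 0 → ‖v‖ < 1 → T' (u, v) ∈ LC
  /-- Every point of the open unit tube of the last component is a virtual point of a point of
  `M_k` off the cores and of potential `< 1 - 3η`. -/
  T'_spec : ∀ (u : 𝕊 1) (v : 𝔼 2), ‖v‖ < 1 →
    ∃ p ∈ Mset k, p.2 ≠ 0 ∧ planarPot k p.1 < 1 - 3 * η ∧ virtS k η p = T' (u, v)
  /-- The zero section of the last tube is the picture of the model knot. -/
  T'_zero : ∀ u : 𝕊 1, T' (u, 0) = virtS k η (KC u)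
  /-- The model knot lies in `M_k`. -/
  KC_mem : ∀ t, KC t ∈ Mset k
  /-- The model knot has potential `≤ 1 - 4η`. -/
  KC_pot : ∀ t, planarPot k (KC t).1 ≤ 1 - 4 * η
  /-- The model knot misses the cores. -/
  KC_snd : ∀ t, (KC t).2 ≠ 0
  /-- The picture of the model knot is not in the link complement. -/
  KC_virt : ∀ t, virtS k η (KC t) ∉ LC
  /-- Virtual points of `M_k ∖ K` off the cores lie in the link complement. -/
  virt_mem : ∀ p ∈ Mset k, p ∉ range KC → p.2 ≠ 0 → virtS k η p ∈ LC
  /-- Outer core points of the outer core zone lie in the link complement. -/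
  outS_mem : ∀ q ∈ zoneO k η, outS k q ∈ LC

namespace Gluing

variable {k : ℕ} {η : ℝ} {Y : Type*} [TopologicalSpace Y] [ChartedSpace (𝔼 3) Y]
  (G : Gluing k η Y)

/-- **The complement of the knot in the model**: `M_k ∖ K` in complex coordinates. [folklore] -/
def Sset : Set (ℂ × ℂ) := {p | p ∈ Mset k ∧ p ∉ range G.KC}

/-- The model map of the gluing data. [folklore] -/
def map : ℂ × ℂ → Y := modelMap k η G.JA G.JB G.fl

/-- A point glued from the complement has nonzero disc coordinate. [folklore] -/
theorem glue_fst_ne_zero (i : Fin (k + 1)) {a : 𝕊 3} (ha : a ∈ G.LC) {b : (𝔼 2) × (𝕊 1)}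
    (hb : ‖b.1‖ < 1) (h : G.JA a = G.JB i b) : b.1 ≠ 0 := by
  have key : ∀ (u : 𝕊 1) (t : ℝ), t ∈ Ioo (0 : ℝ) 1 → b.1 = t • (u : 𝔼 2) → b.1 ≠ 0 := by
    intro u t ht hb1
    rw [hb1]; exact smul_ne_zero ht.1.ne' (ne_zero_of_mem_unit_sphere u)
  induction i using Fin.lastCases with
  | last =>
    obtain ⟨u, t, ht, hb1, -⟩ := (G.glueL a ha b hb).1 h
    exact key u t ht hb1
  | cast j =>
    obtain ⟨u, t, ht, hb1, -⟩ := (G.glueA j a ha b hb).1 h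
    exact key u t ht hb1

/-- **The pieces agree on the inner core zones**: for `q` in the `j`-th inner core zone with
`w ≠ 0`, `JB j (b_j q) = JA (virtS q)` (glue relation and `virtS_eq_dottedTubeFun`). [folklore] -/
theorem agree (j : Fin k) {q : ℂ × ℂ} (hq : q ∈ zoneA k η j) (hw : q.2 ≠ 0) :
    G.JB (Fin.castSucc j) (bPt k G.fl j q) = G.JA (virtS k η q) := by
  have hw0 : 0 < ‖q.2‖ := norm_pos_iff.2 hw
  have hw1 : ‖q.2‖ < 1 := by linarith [hq.2.1]
  have hb : ‖(bPt k G.fl j q).1‖ < 1 := by rw [norm_bPt_fst]; exact hw1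
  -- the tube point and its membership in the complement
  set u : 𝕊 1 := radialProjection (circlePoint 0) (toE2 (conj q.2)) with hu
  have hvirt := virtS_eq_dottedTubeFun G.hη hq.1 hq.2.2.le hw
  have hdir : (‖q.2‖ • (holeDirS k j q.1 : 𝔼 2)) ≠ 0 :=
    smul_ne_zero hw0.ne' (ne_zero_of_mem_unit_sphere _)
  have hmem : virtS k η q ∈ G.LC := by
    rw [hvirt]
    exact G.tubeA_mem j u _ hdir (by rw [norm_smul, Real.norm_of_nonneg hw0.le,
      norm_eq_of_mem_sphere, mul_one]; exact hw1)
  refine ((G.glueA j _ hmem _ hb).2 ⟨u, ‖q.2‖, ⟨hw0, hw1⟩, ?_, ?_⟩).symm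
  · -- `b.1 = |w| • u`
    show toE2 (conj q.2) = ‖q.2‖ • (u : 𝔼 2)
    have h0 : toE2 (conj q.2) ≠ 0 := by rw [Ne, toE2_eq_zero_iff, map_eq_zero]; exact hw
    rw [hu, coe_radialProjection_of_ne_zero _ h0, smul_smul, norm_toE2, Complex.norm_conj,
      mul_inv_cancel₀ hw0.ne', one_smul]
  · rw [hvirt]
    congr 2
    show ‖q.2‖ • (holeDirS k j q.1 : 𝔼 2) = ‖q.2‖ • flipE (G.fl j) (flipS (G.fl j) (holeDirS k j q.1))
    rw [coe_flipS, flipE_flipE]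

/-- The complement of the knot lies in the good set. [folklore] -/
theorem Sset_subset_goodSet : G.Sset ⊆ goodSet k η G.LC := by
  intro p hp
  by_cases hw : p.2 = 0
  · left
    rcases mem_zone_of_core G.hη G.hη' hp.1 hw with ⟨j, hj⟩ | ho
    · exact Or.inl (mem_iUnion.2 ⟨j, hj⟩)
    · exact Or.inr ho
  · right
    have hk : (0 : ℝ) ≤ k := Nat.cast_nonneg k
    exact ⟨hw, ne_holeCentre_of_mem hp.1, by linarith [norm_fst_le_of_mem hp.1],
      G.virt_mem p hp.1 hp.2 hw⟩

/-- **The model map is smooth on the good set.** [folklore] -/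
theorem contMDiffOn : ContMDiffOn 𝓘(ℝ, ℂ × ℂ) (𝓡 3) ∞ G.map (goodSet k η G.LC) :=
  contMDiffOn_modelMap G.hη G.isOpen_LC G.JA_smooth G.JB_smooth (fun j _ hq hw ↦ G.agree j hq hw)
    G.outS_mem

/-- **The model map is injective on the complement of the knot.** [folklore] -/
theorem injOn : InjOn G.map G.Sset := by
  refine (injOn_modelMap G.hη G.hη' G.JA_inj G.JB_inj G.JB_disj
    (fun i a ha b hb h ↦ G.glue_fst_ne_zero i ha hb h) (fun j _ hq hw ↦ G.agree j hq hw)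
    G.outS_mem).mono ?_
  intro p hp
  exact ⟨hp.1, fun hw ↦ G.virt_mem p hp.1 hp.2 hw⟩

/-- Off the cores the model map is `JA ∘ virtS`. [folklore] -/
theorem map_eq_of_ne_zero {p : ℂ × ℂ} (hw : p.2 ≠ 0) : G.map p = G.JA (virtS k η p) :=
  modelMap_eq_of_ne_zero G.hη (fun j _ hq hw ↦ G.agree j hq hw) hw

/-- Knot points have potential `≤ 1 − η` and vanishing cutoff. [folklore] -/
theorem KC_pot' (t : 𝕊 1) : planarPot k (G.KC t).1 ≤ 1 - η ∧ cutoff η (planarPot k (G.KC t).1) = 0 := by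
  have h := G.KC_pot t
  have hη := G.hη
  exact ⟨by linarith, cutoff_eq_zero hη (by linarith)⟩

/-- A point of `M_k` with potential `> 1 − η` is not on the knot. [folklore] -/
theorem not_mem_range_KC_of_pot {p : ℂ × ℂ} (hg : 1 - η < planarPot k p.1) : p ∉ range G.KC := by
  rintro ⟨t, rfl⟩
  have := (G.KC_pot' t).1
  linarith

/-- A point of `M_k` off the cores whose virtual point lies in the complement is not on the knot.
[folklore] -/
theorem not_mem_range_KC_of_virtS {p : ℂ × ℂ} (h : virtS k η p ∈ G.LC) : p ∉ range G.KC := by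
  rintro ⟨t, rfl⟩
  exact G.KC_virt t h

/-- `JA ∘ JAinv = id` on `JA '' LC`. [folklore] -/
theorem JA_JAinv {y : Y} (hy : y ∈ G.JA '' G.LC) : G.JA (G.JAinv y) = y := by
  obtain ⟨a, ha, rfl⟩ := hy
  rw [G.JAinv_JA a ha]

/-- `JAinv` maps `JA '' LC` into `LC`. [folklore] -/
theorem JAinv_mem {y : Y} (hy : y ∈ G.JA '' G.LC) : G.JAinv y ∈ G.LC := by
  obtain ⟨a, ha, rfl⟩ := hy
  rw [G.JAinv_JA a ha]; exact ha

/-- `JB i ∘ JBinv i = id` on the image of the open solid torus. [folklore] -/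
theorem JB_JBinv (i : Fin (k + 1)) {y : Y} (hy : y ∈ G.JB i '' {b | ‖b.1‖ < 1}) :
    G.JB i (G.JBinv i y) = y := by
  obtain ⟨b, hb, rfl⟩ := hy
  rw [G.JBinv_JB i b hb]

/-- `JBinv i` maps the image of the open solid torus into it. [folklore] -/
theorem JBinv_mem (i : Fin (k + 1)) {y : Y} (hy : y ∈ G.JB i '' {b | ‖b.1‖ < 1}) :
    ‖(G.JBinv i y).1‖ < 1 := by
  obtain ⟨b, hb, rfl⟩ := hy
  rw [G.JBinv_JB i b hb]; exact hb

end Gluing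

end MMSW

end Literature.Topology.FourManifolds
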